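import Literature.NumberTheory.Automorphic.UnitaryGroupIsotropicLineElements     -- ★ `lineRoot`, `lineRootGL`, `lineDilation`, `lineDilationGL`, `lineProj`, `hermForm` API
import HarnessLib

/-!
# Moving a hyperbolic pair by explicit elements of a unitary group: root elements of the two lines and the dilation (crux H413, 13a road A′, brick W3)

Cell `hodgecm-mathlib`, Track B «K2-LIT», crux item `stmt-HodgeConjecture-24833` (h413), line `K2_E3_EllipticInputs`, row 13a `sig_K2E3LocalIrrepAdmissible`; seat K2E3-p09
(g3), road A′ «compact-set currency» (MEMO-A′), brick W3.  THEOREMS ONLY — no `def`, no named fact, no instance, no notation, no `sorry`; count-neutral helper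
(`--supports stmt-HodgeConjecture-24833 --as helper`).

PURE ALGEBRA over a commutative ring `S` with an involution `σ` and a `σ`-hermitian matrix `H` (`h = hermForm σ H`, `σ`-semilinear in the first variable).  Fix a
HYPERBOLIC PAIR `(x, y)` (`h(x,x) = h(y,y) = 0`, `h(x,y) = 1`).  The root elements of the two isotropic lines `S x`, `S y` and the dilation of the pair (all ★
`UnitaryGroupIsotropicLineElements`) move `(x, y)` to any other hyperbolic pair `(v, v′)` whose first vector has an INVERTIBLE `x`-coordinate `h(y, v)`, by EXPLICIT
formulas — the elementary «Witt moves» of the weak Cartan decomposition (MEMO-A′ step (A)); their matrix entries are polynomial in the data (and in `h(y,v)⁻¹`), which is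
what the bounded-pivoting analysis of the sequel uses.

* §1 `isotropy_coefficient` — for `v = a • x + b • y + w` with `w ⊥ x, y`: `h(v,v) = σ a · b + σ b · a + h(w,w)` (the Heisenberg constraint in coordinates).
* §2 **`lineRoot_partner_mulVec`**, **`lineRootGL_partner_mem`**: for `v` isotropic with `h(x, v) = 1`, the root element `T_x(lineProj v, h(y,v))` of the line `S x` lies in
  `U(σ, H)`, FIXES `x` and maps `y ↦ v`.
* §3 **`dilation_mul_lineRoot_mulVec_left`**, **`…_mem`**: for `v` isotropic with `h(y, v) = α` a unit, `D(α, (σα)⁻¹) · T_y(lineProj v, h(x,v)·σα)` lies in `U(σ, H)` and maps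
  `x ↦ v` (and `y ↦ (σα)⁻¹ y`).
* §4 **`exists_mem_unitary_mulVec_pair_eq`**: for a hyperbolic pair `(v, v′)` with `h(y, v)` a unit there is `ω ∈ U(σ, H)` with `ω x = v`, `ω y = v′` — §3 then §2 applied
  to `ω′⁻¹ v′`.

HONEST LABEL: structure lemma; HC_CM is proved only modulo the 7 printed citations (2 remaining named inputs: hLiu418 = stmt-HodgeConjecture-24832, h413 =
stmt-HodgeConjecture-24833) until rung 0 closes.

## References
* [Dieudonne1971GroupesClassiques] J. Dieudonné, *La géométrie des groupes classiques*, 3e éd. (1971), Chap. I §11 (Witt's theorem), Chap. II §5 (transvections).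
* [MoeglinVignerasWaldspurger1987] C. Mœglin, M.-F. Vignéras, J.-L. Waldspurger, LNM 1291 (1987), Chap. 1 I.17, Chap. 3 §IV.2.
* [BruhatTits1972] F. Bruhat, J. Tits, *Groupes réductifs sur un corps local I*, Publ. Math. IHÉS 41 (1972), (4.4.3).
-/

set_option autoImplicit false
-- the mandated namespace repeats `HodgeConjecture.HodgeConjecture`, as in every `Theorems/*.lean` of this sub-problem
set_option linter.dupNamespace false

noncomputable section

open Matrix

namespace Summit.HodgeConjecture.HodgeConjecture.Cruxes.H413.K2E3HyperbolicPairTransport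

open Literature.NumberTheory.Automorphic Literature.NumberTheory.Automorphic.UnitaryGroup

variable {S : Type*} [CommRing S] (σ : S →+* S) {n : Type*} [Fintype n] [DecidableEq n] (H : Matrix n n S)

/-! ## §1 The isotropy constraint in the coordinates of a hyperbolic pair -/

/-- **`h(a x + b y + w, a x + b y + w) = σa·b + σb·a + h(w,w)`** for a hyperbolic pair `(x, y)` and `w ⊥ x, y`. [cite: Dieudonne1971GroupesClassiques, Chap. II §5] -/
theorem isotropy_coefficient {x y w : n → S} (hx : hermForm σ H x x = 0) (hy : hermForm σ H y y = 0) (hxy : hermForm σ H x y = 1)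
    (hyx : hermForm σ H y x = 1) (hxw : hermForm σ H x w = 0) (hwx : hermForm σ H w x = 0) (hyw : hermForm σ H y w = 0) (hwy : hermForm σ H w y = 0)
    (a b : S) :
    hermForm σ H (a • x + b • y + w) (a • x + b • y + w) = σ a * b + σ b * a + hermForm σ H w w := by
  simp only [hermForm_add_left, hermForm_add_right, hermForm_smul_left_eq, hermForm_smul_right, hx, hy, hxy, hyx, hxw, hwx, hyw, hwy]
  ring

/-! ## §2 The root element of the line `S x` moving the partner: `y ↦ v` -/

section Partner

variable {x y v : n → S}

/-- The `{x,y}^⊥`-component of `v` is orthogonal to `x` ON THE LEFT as well: `h(lineProj v, x) = 0` (`σ` an involution, `H` hermitian).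
[cite: Dieudonne1971GroupesClassiques, Chap. II §5] -/
theorem hermForm_lineProj_left (hσ : ∀ s, σ (σ s) = s) (hH : (H.map σ)ᵀ = H) (hx : hermForm σ H x x = 0) (hxy : hermForm σ H x y = 1) (v : n → S) :
    hermForm σ H (lineProj σ H x y v) x = 0 := by
  rw [← conj_hermForm σ H hσ hH, hermForm_left_lineProj σ H hx hxy, map_zero]

/-- … and `h(lineProj v, y) = 0`. [cite: Dieudonne1971GroupesClassiques, Chap. II §5] -/
theorem hermForm_lineProj_partner (hσ : ∀ s, σ (σ s) = s) (hH : (H.map σ)ᵀ = H) (hy : hermForm σ H y y = 0) (hyx : hermForm σ H y x = 1) (v : n → S) :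
    hermForm σ H (lineProj σ H x y v) y = 0 := by
  rw [← conj_hermForm σ H hσ hH, hermForm_partner_lineProj σ H hy hyx, map_zero]

/-- **The Heisenberg constraint holds for an isotropic target**: if `h(v,v) = 0` and `h(x,v) = 1` then `z + σ z + h(w,w) = 0` for `z = h(y,v)`, `w = lineProj v`
(so the root element `T_x(w, z)` is defined in `U`). [cite: Dieudonne1971GroupesClassiques, Chap. II §5] -/
theorem partner_constraint (hσ : ∀ s, σ (σ s) = s) (hH : (H.map σ)ᵀ = H) (hx : hermForm σ H x x = 0) (hy : hermForm σ H y y = 0)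
    (hxy : hermForm σ H x y = 1) (hvv : hermForm σ H v v = 0) (hxv : hermForm σ H x v = 1) :
    hermForm σ H y v + σ (hermForm σ H y v) + hermForm σ H (lineProj σ H x y v) (lineProj σ H x y v) = 0 := by
  have hyx : hermForm σ H y x = 1 := by rw [← conj_hermForm σ H hσ hH, hxy, map_one]
  have hdec := lineProj_decomp σ H x y v
  rw [hxv] at hdec
  have key := isotropy_coefficient σ H hx hy hxy hyx (hermForm_left_lineProj σ H hx hxy v) (hermForm_lineProj_left σ H hσ hH hx hxy v)
    (hermForm_partner_lineProj σ H hy hyx v) (hermForm_lineProj_partner σ H hσ hH hy hyx v) (hermForm σ H y v) 1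
  rw [← hdec, hvv, map_one, mul_one, one_mul] at key
  linear_combination -key

/-- **The root element of the line `S x` with parameters `(lineProj v, h(y,v))` maps `y ↦ v`** (`h(x,v) = 1`).
[cite: Dieudonne1971GroupesClassiques, Chap. II §5] -/
theorem lineRoot_partner_mulVec (hσ : ∀ s, σ (σ s) = s) (hH : (H.map σ)ᵀ = H) (hy : hermForm σ H y y = 0) (hxy : hermForm σ H x y = 1)
    (hxv : hermForm σ H x v = 1) :
    lineRoot σ H x (lineProj σ H x y v) (hermForm σ H y v) *ᵥ y = v := by
  have hyx : hermForm σ H y x = 1 := by rw [← conj_hermForm σ H hσ hH, hxy, map_one]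
  rw [lineRoot_mulVec_partner σ H _ _ hxy, hermForm_lineProj_partner σ H hσ hH hy hyx v, sub_zero]
  have hdec := lineProj_decomp σ H x y v
  rw [hxv, one_smul] at hdec
  conv_rhs => rw [hdec]
  abel

/-- … and fixes `x`. [cite: Dieudonne1971GroupesClassiques, Chap. II §5] -/
theorem lineRoot_partner_mulVec_left (hσ : ∀ s, σ (σ s) = s) (hH : (H.map σ)ᵀ = H) (hx : hermForm σ H x x = 0) (hxy : hermForm σ H x y = 1) :
    lineRoot σ H x (lineProj σ H x y v) (hermForm σ H y v) *ᵥ x = x :=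
  lineRoot_mulVec_self σ H _ hx (hermForm_lineProj_left σ H hσ hH hx hxy v)

/-- **… and lies in `U(σ, H)`** when `v` is isotropic with `h(x,v) = 1` (as the unit ★ `lineRootGL`). [cite: Dieudonne1971GroupesClassiques, Chap. II §5] -/
theorem lineRootGL_partner_mem (hσ : ∀ s, σ (σ s) = s) (hH : (H.map σ)ᵀ = H) (hx : hermForm σ H x x = 0) (hy : hermForm σ H y y = 0)
    (hxy : hermForm σ H x y = 1) (hvv : hermForm σ H v v = 0) (hxv : hermForm σ H x v = 1) :
    lineRootGL σ H (hermForm σ H y v) hx (hermForm_lineProj_left σ H hσ hH hx hxy v) (hermForm_left_lineProj σ H hx hxy v) ∈ unitaryGroupOfForm σ H :=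
  lineRootGL_mem σ H hσ hH hx _ _ (partner_constraint σ H hσ hH hx hy hxy hvv hxv)

end Partner

/-! ## §3 The dilation times the root element of the line `S y` moving the first vector: `x ↦ v` -/

section First

variable {x y v : n → S}

/-- **The constraint of the opposite root element**: for `v` isotropic with `h(y,v) = α`, `h(x,v) = γ`, `w′ = lineProj v`: `z′ + σ z′ + h(w′,w′) = 0` with `z′ = γ · σα`.
[cite: Dieudonne1971GroupesClassiques, Chap. II §5] -/
theorem first_constraint (hσ : ∀ s, σ (σ s) = s) (hH : (H.map σ)ᵀ = H) (hx : hermForm σ H x x = 0) (hy : hermForm σ H y y = 0)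
    (hxy : hermForm σ H x y = 1) (hvv : hermForm σ H v v = 0) :
    hermForm σ H x v * σ (hermForm σ H y v) + σ (hermForm σ H x v * σ (hermForm σ H y v)) +
      hermForm σ H (lineProj σ H x y v) (lineProj σ H x y v) = 0 := by
  have hyx : hermForm σ H y x = 1 := by rw [← conj_hermForm σ H hσ hH, hxy, map_one]
  have hdec := lineProj_decomp σ H x y v
  have key := isotropy_coefficient σ H hx hy hxy hyx (hermForm_left_lineProj σ H hx hxy v) (hermForm_lineProj_left σ H hσ hH hx hxy v)
    (hermForm_partner_lineProj σ H hy hyx v) (hermForm_lineProj_partner σ H hσ hH hy hyx v) (hermForm σ H y v) (hermForm σ H x v)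
  rw [← hdec, hvv] at key
  rw [map_mul, hσ]
  linear_combination -key

/-- **`D(α, (σα)⁻¹) · T_y(w′, γ σα)` maps `x ↦ v`** for `v` isotropic with `h(y,v) = α ∈ Sˣ`, `γ = h(x,v)`, `w′ = lineProj v` (on matrices).
[cite: Dieudonne1971GroupesClassiques, Chap. I §11, Chap. II §5] -/
theorem dilation_mul_lineRoot_mulVec_left (hσ : ∀ s, σ (σ s) = s) (hH : (H.map σ)ᵀ = H) (hx : hermForm σ H x x = 0) (hy : hermForm σ H y y = 0)
    (hxy : hermForm σ H x y = 1) (α : Sˣ) (hα : hermForm σ H y v = α) :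
    (lineDilation σ H x y (α : S) (((Units.map (σ : S →* S) α)⁻¹ : Sˣ) : S) *
        lineRoot σ H y (lineProj σ H x y v) (hermForm σ H x v * σ (hermForm σ H y v))) *ᵥ x = v := by
  have hyx : hermForm σ H y x = 1 := by rw [← conj_hermForm σ H hσ hH, hxy, map_one]
  have hw'x := hermForm_lineProj_left σ H hσ hH hx hxy v
  have hxw' := hermForm_left_lineProj σ H hx hxy v
  have hyw' := hermForm_partner_lineProj σ H hy hyx v
  rw [← Matrix.mulVec_mulVec, lineRoot_mulVec_partner σ H _ _ hyx, hw'x, sub_zero, Matrix.mulVec_add, Matrix.mulVec_add, Matrix.mulVec_smul,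
    lineDilation_mulVec_left σ H _ _ hx hyx, lineDilation_mulVec_of_orth σ H _ _ hxw' hyw', lineDilation_mulVec_partner σ H _ _ hy hxy, smul_smul]
  have hcoef : hermForm σ H x v * σ (hermForm σ H y v) * (((Units.map (σ : S →* S) α)⁻¹ : Sˣ) : S) = hermForm σ H x v := by
    rw [hα, show σ (α : S) = ((Units.map (σ : S →* S) α : Sˣ) : S) from rfl, mul_assoc, Units.mul_inv, mul_one]
  rw [hcoef]
  have hdec := lineProj_decomp σ H x y v
  rw [hα] at hdec
  conv_rhs => rw [hdec]
  abel

/-- … and `y ↦ (σα)⁻¹ • y`. [cite: Dieudonne1971GroupesClassiques, Chap. II §5] -/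
theorem dilation_mul_lineRoot_mulVec_partner (hσ : ∀ s, σ (σ s) = s) (hH : (H.map σ)ᵀ = H) (hy : hermForm σ H y y = 0)
    (hxy : hermForm σ H x y = 1) (α : Sˣ) :
    (lineDilation σ H x y (α : S) (((Units.map (σ : S →* S) α)⁻¹ : Sˣ) : S) *
        lineRoot σ H y (lineProj σ H x y v) (hermForm σ H x v * σ (hermForm σ H y v))) *ᵥ y =
      (((Units.map (σ : S →* S) α)⁻¹ : Sˣ) : S) • y := by
  have hyx : hermForm σ H y x = 1 := by rw [← conj_hermForm σ H hσ hH, hxy, map_one]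
  rw [← Matrix.mulVec_mulVec, lineRoot_mulVec_self σ H _ hy (hermForm_lineProj_partner σ H hσ hH hy hyx v),
    lineDilation_mulVec_partner σ H _ _ hy hxy]

/-- **… and lies in `U(σ, H)`** when `v` is isotropic (as a product of the units ★ `lineDilationGL`, ★ `lineRootGL`).
[cite: Dieudonne1971GroupesClassiques, Chap. I §11, Chap. II §5] -/
theorem dilationGL_mul_lineRootGL_mem (hσ : ∀ s, σ (σ s) = s) (hH : (H.map σ)ᵀ = H) (hx : hermForm σ H x x = 0) (hy : hermForm σ H y y = 0)
    (hxy : hermForm σ H x y = 1) (hyx : hermForm σ H y x = 1) (hvv : hermForm σ H v v = 0) (α : Sˣ) :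
    lineDilationGL σ H hx hy hxy hyx α (Units.map (σ : S →* S) α)⁻¹ *
        lineRootGL σ H (hermForm σ H x v * σ (hermForm σ H y v)) hy (hermForm_lineProj_partner σ H hσ hH hy hyx v)
          (hermForm_partner_lineProj σ H hy hyx v) ∈ unitaryGroupOfForm σ H := by
  refine Subgroup.mul_mem _ (lineDilationGL_mem σ H hσ hH hx hy hxy hyx ?_) (lineRootGL_mem σ H hσ hH hy _ _ (first_constraint σ H hσ hH hx hy hxy hvv))
  rw [show σ (α : S) = ((Units.map (σ : S →* S) α : Sˣ) : S) from rfl, ← Units.val_mul, mul_inv_cancel, Units.val_one]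

end First

/-! ## §4 Moving the pair `(x, y) ↦ (v, v′)` -/

section Pair

variable {x y v v' : n → S}

/-- **WITT MOVE ON HYPERBOLIC PAIRS, explicit**: for hyperbolic pairs `(x, y)` and `(v, v′)` with `h(y, v) = α` a UNIT there is `ω ∈ U(σ, H)` with `ω x = v` and `ω y = v′`:
`ω = ω′ · T_x(lineProj u, h(y,u))` with `ω′ = D(α,(σα)⁻¹) · T_y(…)` (§3, `ω′ x = v`) and `u = ω′⁻¹ v′` (isotropic with `h(x,u) = h(v,v′) = 1`, §2).
[cite: Dieudonne1971GroupesClassiques, Chap. I §11] [cite: BruhatTits1972, (4.4.3)] -/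
theorem exists_mem_unitary_mulVec_pair_eq (hσ : ∀ s, σ (σ s) = s) (hH : (H.map σ)ᵀ = H) (hx : hermForm σ H x x = 0) (hy : hermForm σ H y y = 0)
    (hxy : hermForm σ H x y = 1) (hvv : hermForm σ H v v = 0) (hv'v' : hermForm σ H v' v' = 0) (hvv' : hermForm σ H v v' = 1)
    (α : Sˣ) (hα : hermForm σ H y v = α) :
    ∃ ω : GL n S, ω ∈ unitaryGroupOfForm σ H ∧ (ω : Matrix n n S) *ᵥ x = v ∧ (ω : Matrix n n S) *ᵥ y = v' := by
  have hyx : hermForm σ H y x = 1 := by rw [← conj_hermForm σ H hσ hH, hxy, map_one]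
  -- `ω′ x = v`
  set ω' : GL n S := lineDilationGL σ H hx hy hxy hyx α (Units.map (σ : S →* S) α)⁻¹ *
    lineRootGL σ H (hermForm σ H x v * σ (hermForm σ H y v)) hy (hermForm_lineProj_partner σ H hσ hH hy hyx v)
      (hermForm_partner_lineProj σ H hy hyx v) with hω'
  have hω'U : ω' ∈ unitaryGroupOfForm σ H := dilationGL_mul_lineRootGL_mem σ H hσ hH hx hy hxy hyx hvv α
  have hω'x : (ω' : Matrix n n S) *ᵥ x = v := by
    rw [hω', Units.val_mul, coe_lineDilationGL, coe_lineRootGL]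
    exact dilation_mul_lineRoot_mulVec_left σ H hσ hH hx hy hxy α hα
  -- `u = ω′⁻¹ v′`: isotropic, `h(x, u) = 1`
  set u : n → S := ((ω'⁻¹ : GL n S) : Matrix n n S) *ᵥ v' with hu
  have hiso := (mem_unitaryGroupOfForm_iff_hermForm σ H ω').1 hω'U
  have hω'u : (ω' : Matrix n n S) *ᵥ u = v' := by
    rw [hu, Matrix.mulVec_mulVec, ← Units.val_mul, mul_inv_cancel, Units.val_one, Matrix.one_mulVec]
  have huu : hermForm σ H u u = 0 := by rw [← hiso u u, hω'u, hv'v']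
  have hxu : hermForm σ H x u = 1 := by rw [← hiso x u, hω'x, hω'u, hvv']
  -- `T x = x`, `T y = u`
  refine ⟨ω' * lineRootGL σ H (hermForm σ H y u) hx (hermForm_lineProj_left σ H hσ hH hx hxy u) (hermForm_left_lineProj σ H hx hxy u),
    Subgroup.mul_mem _ hω'U (lineRootGL_partner_mem σ H hσ hH hx hy hxy huu hxu), ?_, ?_⟩
  · rw [Units.val_mul, ← Matrix.mulVec_mulVec, coe_lineRootGL, lineRoot_partner_mulVec_left σ H hσ hH hx hxy, hω'x]
  · rw [Units.val_mul, ← Matrix.mulVec_mulVec, coe_lineRootGL, lineRoot_partner_mulVec σ H hσ hH hy hxy hxu, hω'u]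

end Pair

end Summit.HodgeConjecture.HodgeConjecture.Cruxes.H413.K2E3HyperbolicPairTransport

end
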